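import Literature.NumberTheory.LFunctions.DirichletLFunctionLogDerivBound
import Literature.NumberTheory.LFunctions.SiegelExceptionalZeroBound
import Literature.NumberTheory.LFunctions.ClassicalPsiErrorTermExplicit
import Literature.NumberTheory.Sieve.ParityWave0
import HarnessLib

/-!
# The Siegel–Walfisz theorem (Montgomery–Vaughan Corollary 11.19): parity.S28 proved

Topic `Literature/NumberTheory/LFunctions`. Everything in this file is PROVED (theorems only); it
discharges the named fact `Literature.NumberTheory.Sieve.siegel_walfisz` (`ParityWave0.lean`, parity.S28):

> for every `A > 0` there is an (ineffective) `C` such that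
> `|ψ(x; q, a) − x/φ(q)| ≤ C x (log x)^{-A}` for all `x ≥ 2`, `1 ≤ q ≤ (log x)^A`, `(a, q) = 1`
> (Walfisz 1936; Montgomery–Vaughan, *Multiplicative Number Theory I*, Cor. 11.19;
> Iwaniec–Kowalski Cor. 5.29).

## The argument (MV §11.3, with the contour kept to the right of the exceptional zero)

For `(a, q) = 1` the non-negative sequence `Λ_{q,a}(n) = φ(q) Λ(n) 𝟙_{n ≡ a (q)}` has Dirichlet
series `∑_χ χ̄(a)(−L'/L(s, χ)) = 1/(s−1) + F_{q,a}(s)` (MV (11.22); Mathlib's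
`ArithmeticFunction.vonMangoldt.LFunctionResidueClassAux`), where
`F_{q,a} = −(L₁'/L₁)(s, χ₀) − ∑_{χ ≠ χ₀} χ̄(a) L'/L(s, χ)`, `L₁(s, χ₀) = (s−1)L(s, χ₀) =
ζ₁(s) ∏_{p ∣ q}(1 − p^{-s})`. We verify the hypotheses `Literature.ClassicalPsiData Λ_{q,a} F_{q,a} c_q C_q`
of Landau's method (`ClassicalPsiErrorTerm.lean`) on the region `σ > 1 − c_q/log(|t| + 4)` with

  `c_q = min(c₃/(1 + log q), κ q^{-ε}/8, c_ζ, 1/4)`,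

where `c₃` is the constant of the zero-free region / log-derivative bound for `L(s, χ)`
(`DirichletLFunctionLogDerivBound.lean`, MV Theorems 11.3–11.4), `c_ζ` that of `ζ`
(`ZetaZeroFreeRegion.lean`), and `κ q^{-ε} ≤ 1 − β` for every real zero `β` of a quadratic
`L(s, χ)` mod `q` (Siegel, MV Cor. 11.15, `SiegelExceptionalZeroBound.lean`): this region contains
no zero of any `L(s, χ)`, `χ` mod `q` — the complex zeros by MV Theorem 11.3, the real ones being
kept at distance `≥ κq^{-ε}/2` to its left (MV Theorem 11.16, Case 3: "we proceed exactly as in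
Case 1") — and on it `|F_{q,a}(s)| ≤ C_q log(|t| + 4)` with `C_q` polynomial in `q`. The
explicit form of Landau's theorem (`ClassicalPsiErrorTermExplicit.lean`, MV Thm. 6.9) then gives
`|φ(q)ψ(x; q, a) − x| ≤ K_q x exp(−(c_q/24)√log x)` with `K_q` polynomial in `q, 1/c_q`, and for
`q ≤ (log x)^A`, `ε = 1/(4A)` this is `≪_A x (log x)^{-A}` (MV Cor. 11.18–11.19: Siegel's theorem
makes the exceptional-zero saving `exp(−C(ε) q^{-ε} …)` beat every power of `log x`).

## Main results

* `Literature.NumberTheory.LFunctions.SiegelWalfisz.LFunctionTrivChar₁_eq` — `L₁(s, χ₀) = ζ₁(s) ∏_{p ∣ q}(1 − p^{-s})` (MV (4.22));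
* `Literature.NumberTheory.LFunctions.SiegelWalfisz.exists_classicalPsiData` — the hypotheses of Landau's method for `Λ_{q,a}`,
  uniformly in `q` (MV Theorem 11.16, Cases 1/3, with Cor. 11.15);
* `Literature.Parity.siegel_walfisz_holds : Literature.Parity.siegel_walfisz` — **parity.S28** (MV Cor. 11.19).

## References

* A. Walfisz, *Zur additiven Zahlentheorie. II*, Math. Z. 40 (1936), 592–607 (`Walfisz1936`).
* H. L. Montgomery, R. C. Vaughan, *Multiplicative Number Theory I. Classical Theory*, Cambridge
  Stud. Adv. Math. 97 (2007), §11.3: (11.22), Theorem 11.16, Corollaries 11.17–11.19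
  (`MontgomeryVaughan2007`).
-/

noncomputable section

open Complex Filter Topology Metric Set Finset
open scoped LSeries.notation ArithmeticFunction.vonMangoldt

namespace Literature.NumberTheory.LFunctions.SiegelWalfisz

/-! ## The principal character: `L₁(s, χ₀) = ζ₁(s) ∏_{p ∣ q} (1 − p^{-s})` -/

/-- **MV (4.22) for the completed functions**: Mathlib's entire `L₁(s, χ₀) = (s − 1)L(s, χ₀)`
(`DirichletCharacter.LFunctionTrivChar₁ q`) equals `ζ₁(s) ∏_{p ∣ q}(1 − p^{-s})` for every `s`
(`ζ₁ = (s−1)ζ` Mathlib's `riemannZeta₁`; at `s = 1` both sides are `∏_{p ∣ q}(1 − 1/p)`).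
[cite: MontgomeryVaughan2007, §11.1 Lemma 11.1 (proof, eq. (4.22))] -/
theorem LFunctionTrivChar₁_eq (q : ℕ) [NeZero q] (s : ℂ) :
    DirichletCharacter.LFunctionTrivChar₁ q s =
      (∏ p ∈ q.primeFactors, (1 - (p : ℂ) ^ (-s))) * riemannZeta₁ s := by
  rcases eq_or_ne s 1 with rfl | hs
  · rw [DirichletCharacter.LFunctionTrivChar₁, Function.update_self, riemannZeta₁_one, mul_one]
    refine Finset.prod_congr rfl fun p _ ↦ ?_
    rw [Complex.cpow_neg_one]
  · rw [DirichletCharacter.LFunctionTrivChar₁, Function.update_of_ne hs,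
      DirichletCharacter.LFunctionTrivChar_eq_mul_riemannZeta hs, Literature.NumberTheory.LFunctions.riemannZeta₁_eq_mul hs]
    ring

/-- The Euler factor `P_q(s) = ∏_{p ∣ q}(1 − p^{-s})` is entire. [folklore] -/
theorem differentiable_eulerFactor (q : ℕ) :
    Differentiable ℂ (fun s : ℂ ↦ ∏ p ∈ q.primeFactors, (1 - (p : ℂ) ^ (-s))) := by
  refine Differentiable.fun_finsetProd (𝕜 := ℂ) (f := fun (p : ℕ) (s : ℂ) ↦ 1 - (p : ℂ) ^ (-s))
    fun p hp ↦ ?_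
  have hp0 : (p : ℂ) ≠ 0 := Nat.cast_ne_zero.2 (Nat.prime_of_mem_primeFactors hp).ne_zero
  exact (differentiable_const (1 : ℂ)).sub
    ((differentiable_id (𝕜 := ℂ)).neg.const_cpow (c := (p : ℂ)) (Or.inl hp0))

/-- For a prime `p` and `σ = Re s ≥ 3/4`: `‖p^{-s}‖ ≤ 3/4`. (`p^{-σ} ≤ 2^{-1/2} = 1/√2 ≤ 3/4`.)
[folklore] -/
theorem norm_prime_cpow_neg_le {p : ℕ} (hp : p.Prime) {s : ℂ} (hs : 3 / 4 ≤ s.re) :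
    ‖(p : ℂ) ^ (-s)‖ ≤ 3 / 4 := by
  have hp2 : (2 : ℝ) ≤ p := by exact_mod_cast hp.two_le
  have hp0 : (0 : ℝ) < p := by linarith
  rw [Complex.norm_natCast_cpow_of_pos hp.pos, Complex.neg_re]
  calc (p : ℝ) ^ (-s.re) ≤ (2 : ℝ) ^ (-s.re) :=
        Real.rpow_le_rpow_of_nonpos (by norm_num) hp2 (by linarith)
    _ ≤ (2 : ℝ) ^ (-(1 / 2) : ℝ) :=
        Real.rpow_le_rpow_of_exponent_le (by norm_num) (by linarith)
    _ = (Real.sqrt 2)⁻¹ := by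
        rw [Real.rpow_neg (by norm_num), Real.sqrt_eq_rpow]
    _ ≤ 3 / 4 := by
        rw [inv_le_comm₀ (Real.sqrt_pos.2 (by norm_num)) (by norm_num)]
        rw [show (3 / 4 : ℝ)⁻¹ = 4 / 3 by norm_num, Real.le_sqrt (by norm_num) (by norm_num)]
        norm_num

/-- The Euler factor does not vanish for `σ ≥ 3/4`, and its logarithmic derivative is at most
`3 log q` there: `P'/P(s) = ∑_{p ∣ q} (log p) p^{-s}/(1 − p^{-s})`, `|p^{-s}| ≤ 3/4`,
`∑_{p ∣ q} log p ≤ log q` (MV p. 275: "`(log p)/(p^s − 1) ≪ 1` for `σ ≥ 5/6`, so the sum over `p` is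
`≪ ω(q) ≪ log q`"). [cite: MontgomeryVaughan2007, Lemma 11.1 (proof)] -/
theorem eulerFactor_ne_zero_and_norm_logDeriv_le (q : ℕ) [NeZero q] {s : ℂ} (hs : 3 / 4 ≤ s.re) :
    (∏ p ∈ q.primeFactors, (1 - (p : ℂ) ^ (-s))) ≠ 0 ∧
      ‖logDeriv (fun s : ℂ ↦ ∏ p ∈ q.primeFactors, (1 - (p : ℂ) ^ (-s))) s‖ ≤ 3 * Real.log q := by
  have hfac : ∀ p ∈ q.primeFactors, (1 - (p : ℂ) ^ (-s)) ≠ 0 := by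
    intro p hp h
    have hn := norm_prime_cpow_neg_le (Nat.prime_of_mem_primeFactors hp) hs
    rw [sub_eq_zero] at h
    rw [← h, norm_one] at hn
    norm_num at hn
  refine ⟨Finset.prod_ne_zero_iff.2 hfac, ?_⟩
  have hdiff : ∀ p ∈ q.primeFactors, DifferentiableAt ℂ (fun s : ℂ ↦ 1 - (p : ℂ) ^ (-s)) s := by
    intro p hp
    have hp0 : (p : ℂ) ≠ 0 := Nat.cast_ne_zero.2 (Nat.prime_of_mem_primeFactors hp).ne_zero
    exact ((differentiable_const (1 : ℂ)).sub
      ((differentiable_id (𝕜 := ℂ)).neg.const_cpow (c := (p : ℂ)) (Or.inl hp0))) s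
  rw [logDeriv_prod (ι := ℕ) (s := q.primeFactors) (f := fun (p : ℕ) (s : ℂ) ↦ 1 - (p : ℂ) ^ (-s))
    hfac hdiff]
  -- each term
  have hterm : ∀ p ∈ q.primeFactors,
      ‖logDeriv (fun s : ℂ ↦ 1 - (p : ℂ) ^ (-s)) s‖ ≤ 3 * Real.log p := by
    intro p hp
    have hprime := Nat.prime_of_mem_primeFactors hp
    have hp0 : (p : ℂ) ≠ 0 := Nat.cast_ne_zero.2 hprime.ne_zero
    have hlogp : 0 ≤ Real.log p := Real.log_natCast_nonneg p
    have hderiv : deriv (fun s : ℂ ↦ 1 - (p : ℂ) ^ (-s)) s = (p : ℂ) ^ (-s) * Complex.log p := by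
      have h1 : HasDerivAt (fun s : ℂ ↦ (p : ℂ) ^ (-s)) ((p : ℂ) ^ (-s) * Complex.log p * (-1)) s :=
        (hasDerivAt_neg s).const_cpow (Or.inl hp0)
      have h2 : HasDerivAt (fun s : ℂ ↦ 1 - (p : ℂ) ^ (-s)) (0 - (p : ℂ) ^ (-s) * Complex.log p * (-1)) s :=
        (hasDerivAt_const s (1 : ℂ)).sub h1
      rw [h2.deriv]; ring
    have hn := norm_prime_cpow_neg_le hprime hs
    have hden : 1 / 4 ≤ ‖1 - (p : ℂ) ^ (-s)‖ := by
      have := norm_sub_norm_le (1 : ℂ) ((p : ℂ) ^ (-s))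
      rw [norm_one] at this
      linarith
    have hlogC : ‖Complex.log p‖ = Real.log p := by
      rw [show (p : ℂ) = ((p : ℝ) : ℂ) by push_cast; rfl, ← Complex.ofReal_log (Nat.cast_nonneg p),
        Complex.norm_real, Real.norm_of_nonneg hlogp]
    rw [logDeriv_apply, hderiv, norm_div, norm_mul, hlogC]
    rw [div_le_iff₀ (by linarith)]
    nlinarith [norm_nonneg ((p : ℂ) ^ (-s))]
  -- the sum
  have hq0 : 0 < q := Nat.pos_of_ne_zero (NeZero.ne q)
  calc ‖∑ p ∈ q.primeFactors, logDeriv (fun s : ℂ ↦ 1 - (p : ℂ) ^ (-s)) s‖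
      ≤ ∑ p ∈ q.primeFactors, ‖logDeriv (fun s : ℂ ↦ 1 - (p : ℂ) ^ (-s)) s‖ := norm_sum_le _ _
    _ ≤ ∑ p ∈ q.primeFactors, 3 * Real.log p := Finset.sum_le_sum hterm
    _ = 3 * Real.log (∏ p ∈ q.primeFactors, (p : ℝ)) := by
        rw [← Finset.mul_sum, Real.log_prod]
        intro p hp
        exact_mod_cast (Nat.prime_of_mem_primeFactors hp).ne_zero
    _ ≤ 3 * Real.log q := by
        refine mul_le_mul_of_nonneg_left (Real.log_le_log ?_ ?_) (by norm_num)
        · exact Finset.prod_pos fun p hp ↦ by exact_mod_cast (Nat.prime_of_mem_primeFactors hp).pos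
        · rw [← Nat.cast_prod]
          exact_mod_cast Nat.le_of_dvd hq0 (Nat.prod_primeFactors_dvd q)

/-- **`L₁'/L₁(s, χ₀) = ζ₁'/ζ₁(s) + P'/P(s)`, bounded**: if `σ ≥ 3/4` and `ζ₁(s) ≠ 0` then
`L₁(s, χ₀) ≠ 0` and `‖L₁'/L₁(s, χ₀)‖ ≤ ‖ζ₁'/ζ₁(s)‖ + 3 log q`.
[cite: MontgomeryVaughan2007, Lemma 11.1 (proof)] -/
theorem norm_logDeriv_LFunctionTrivChar₁_le (q : ℕ) [NeZero q] {s : ℂ} (hs : 3 / 4 ≤ s.re)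
    (hζ : riemannZeta₁ s ≠ 0) :
    DirichletCharacter.LFunctionTrivChar₁ q s ≠ 0 ∧
      ‖deriv (DirichletCharacter.LFunctionTrivChar₁ q) s / DirichletCharacter.LFunctionTrivChar₁ q s‖ ≤
        ‖deriv riemannZeta₁ s / riemannZeta₁ s‖ + 3 * Real.log q := by
  obtain ⟨hP, hPb⟩ := eulerFactor_ne_zero_and_norm_logDeriv_le q hs
  have hfun : DirichletCharacter.LFunctionTrivChar₁ q =
      fun s ↦ (∏ p ∈ q.primeFactors, (1 - (p : ℂ) ^ (-s))) * riemannZeta₁ s :=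
    funext (LFunctionTrivChar₁_eq q)
  refine ⟨by rw [LFunctionTrivChar₁_eq]; exact mul_ne_zero hP hζ, ?_⟩
  rw [hfun, ← logDeriv_apply, ← logDeriv_apply,
    logDeriv_mul s hP hζ ((differentiable_eulerFactor q) s) (differentiable_riemannZeta₁ s)]
  calc ‖logDeriv (fun s : ℂ ↦ ∏ p ∈ q.primeFactors, (1 - (p : ℂ) ^ (-s))) s + logDeriv riemannZeta₁ s‖
      ≤ ‖logDeriv (fun s : ℂ ↦ ∏ p ∈ q.primeFactors, (1 - (p : ℂ) ^ (-s))) s‖ +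
          ‖logDeriv riemannZeta₁ s‖ := norm_add_le _ _
    _ ≤ 3 * Real.log q + ‖logDeriv riemannZeta₁ s‖ := add_le_add hPb le_rfl
    _ = ‖logDeriv riemannZeta₁ s‖ + 3 * Real.log q := add_comm _ _

/-! ## The region `σ > 1 − c_q/log(|t| + 4)` and the bound for `F_{q,a}` -/

/-- Elementary facts about the region `σ > 1 − c_q/log(|t|+4)` with
`c_q ≤ c₃/(1 + log q)`, `c_q ≤ η/8`, `c_q ≤ c_ζ`, `c_q ≤ 1/4`: it lies in `σ > 3/4`, in the
classical region of `ζ` (`σ ≥ 1 − c_ζ/log(|t|+4)`), and in the region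
`σ ≥ 1 − c₃/(log q + log(|t| + 4))` of `L(s, χ)`. [folklore] -/
theorem region_facts {q : ℕ} {c₃ cζ η cq : ℝ} (hq : (1 : ℝ) ≤ q) (hc₃ : 0 < c₃) (hcq0 : 0 < cq)
    (h1 : cq ≤ c₃ / (1 + Real.log q)) (h2 : cq ≤ η / 8) (h3 : cq ≤ cζ) (h4 : cq ≤ 1 / 4)
    {s : ℂ} (hs : 1 - cq / Real.log (|s.im| + 4) < s.re) :
    3 / 4 < s.re ∧ 1 - η / 8 < s.re ∧ 1 - cζ / Real.log (|s.im| + 4) ≤ s.re ∧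
      1 - c₃ / (Real.log q + Real.log (|s.im| + 4)) ≤ s.re := by
  have hlogτ : 1 ≤ Real.log (|s.im| + 4) := ClassicalZFRData.one_le_log_tau s.im
  have hlogτ0 : 0 < Real.log (|s.im| + 4) := by linarith
  have hlogq : 0 ≤ Real.log q := Real.log_nonneg hq
  have hcq1 : cq / Real.log (|s.im| + 4) ≤ cq := div_le_self hcq0.le hlogτ
  refine ⟨by linarith, by linarith, ?_, ?_⟩
  · have : cq / Real.log (|s.im| + 4) ≤ cζ / Real.log (|s.im| + 4) :=
      div_le_div_of_nonneg_right h3 hlogτ0.le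
    linarith
  · have hden : 0 < 1 + Real.log q := by linarith
    have h5 : cq / Real.log (|s.im| + 4) ≤ c₃ / (Real.log q + Real.log (|s.im| + 4)) := by
      calc cq / Real.log (|s.im| + 4) ≤ (c₃ / (1 + Real.log q)) / Real.log (|s.im| + 4) :=
            div_le_div_of_nonneg_right h1 hlogτ0.le
        _ = c₃ / ((1 + Real.log q) * Real.log (|s.im| + 4)) := by rw [div_div]
        _ ≤ c₃ / (Real.log q + Real.log (|s.im| + 4)) := by
            refine div_le_div_of_nonneg_left hc₃.le (by positivity) ?_
            nlinarith
    linarith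

/-- **The non-principal characters on the region** (MV Theorem 11.16, Cases 1 and 3, with
Siegel's Corollary 11.15): with the constants `c₃, C₃` of
`Literature.NumberTheory.LFunctions.DirichletZFR.exists_norm_logDeriv_le_of_re_ge` and `κ` of
`Literature.NumberTheory.LFunctions.Siegel.exists_one_sub_realZero_ge`, for `χ ≠ χ₀` mod `q` and `s` with `σ > 1 − η/8`,
`σ ≥ 1 − c₃/(log q + log(|t|+4))`, where `η = κ q^{-ε}`: every real zero `β > 1 − 2c₃/(log q + log 4)`
is at distance `≥ min(η/2, 1)` from `s` (for complex `χ` there is none by MV Theorem 11.3; for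
quadratic `χ`, `1 − β ≥ η` by Cor. 11.15 while `σ > 1 − η/8`), hence `L(s, χ) ≠ 0` and
`‖L'/L(s, χ)‖ ≤ C₃ ((log q + log 4)³/min(η/2,1)) log(|t|+4)`.
[cite: MontgomeryVaughan2007, Theorem 11.16 (proof, Cases 1 and 3)] -/
theorem char_facts {c₃ C₃ κ ε : ℝ} (hκ : 0 < κ)
    (hzf : ∀ (q : ℕ) [NeZero q] (χ : DirichletCharacter ℂ q), χ ≠ 1 → ∀ ρ : ℂ, χ.LFunction ρ = 0 →
        1 - 2 * c₃ / (Real.log q + Real.log (|ρ.im| + 4)) < ρ.re → χ ^ 2 = 1 ∧ ρ.im = 0)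
    (hL : ∀ (q : ℕ) [NeZero q] (χ : DirichletCharacter ℂ q), χ ≠ 1 →
      ∀ (s : ℂ) (d : ℝ), 0 < d → d ≤ 1 →
        1 - c₃ / (Real.log q + Real.log (|s.im| + 4)) ≤ s.re →
        (∀ a : ℂ, χ.LFunction a = 0 → a.im = 0 →
          1 - 2 * c₃ / (Real.log q + Real.log 4) < a.re → d ≤ ‖s - a‖) →
        χ.LFunction s ≠ 0 ∧
          ‖deriv χ.LFunction s / χ.LFunction s‖ ≤
            C₃ * ((Real.log q + Real.log 4) ^ 3 / d) * Real.log (|s.im| + 4))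
    (hSiegel : ∀ (q : ℕ) [NeZero q] (χ : DirichletCharacter ℂ q),
      χ ^ 2 = 1 → χ ≠ 1 → ∀ β : ℝ, χ.LFunction β = 0 → κ * (q : ℝ) ^ (-ε) ≤ 1 - β)
    {q : ℕ} [NeZero q] (χ : DirichletCharacter ℂ q) (hχ : χ ≠ 1) {s : ℂ}
    (hsη : 1 - κ * (q : ℝ) ^ (-ε) / 8 < s.re)
    (hs₃ : 1 - c₃ / (Real.log q + Real.log (|s.im| + 4)) ≤ s.re) :
    χ.LFunction s ≠ 0 ∧
      ‖deriv χ.LFunction s / χ.LFunction s‖ ≤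
        C₃ * ((Real.log q + Real.log 4) ^ 3 / min (κ * (q : ℝ) ^ (-ε) / 2) 1) *
          Real.log (|s.im| + 4) := by
  have hq0 : (0 : ℝ) < q := by exact_mod_cast Nat.pos_of_ne_zero (NeZero.ne q)
  have hη : 0 < κ * (q : ℝ) ^ (-ε) := mul_pos hκ (Real.rpow_pos_of_pos hq0 _)
  have hd : 0 < min (κ * (q : ℝ) ^ (-ε) / 2) 1 := lt_min (by linarith) one_pos
  have hd1 : min (κ * (q : ℝ) ^ (-ε) / 2) 1 ≤ 1 := min_le_right _ _
  refine hL q χ hχ s _ hd hd1 hs₃ fun a hLa haim hare ↦ ?_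
  -- `a` is a real zero `β` with `β > 1 − 2c₃/(log q + log 4)`
  obtain ⟨β, rfl⟩ : ∃ β : ℝ, a = β := ⟨a.re, Complex.ext (by simp) (by simp [haim])⟩
  simp only [Complex.ofReal_re] at hare
  -- `χ` is quadratic (else the zero-free region excludes `β`)
  have hχ2 : χ ^ 2 = 1 := by
    refine (hzf q χ hχ β hLa ?_).1
    simpa only [Complex.ofReal_im, abs_zero, zero_add, Complex.ofReal_re] using hare
  have hβ := hSiegel q χ hχ2 hχ β hLa
  have hre : (s - β).re = s.re - β := by simp
  have h1 : s.re - β ≤ ‖s - (β : ℂ)‖ := by rw [← hre]; exact Complex.re_le_norm _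
  calc min (κ * (q : ℝ) ^ (-ε) / 2) 1 ≤ κ * (q : ℝ) ^ (-ε) / 2 := min_le_left _ _
    _ ≤ s.re - β := by linarith
    _ ≤ ‖s - (β : ℂ)‖ := h1

/-- The number of Dirichlet characters mod `q` other than `χ₀` is at most `q`
(`#{χ mod q} = φ(q) ≤ q`). [folklore] -/
theorem card_compl_one_le (q : ℕ) [NeZero q] {inst : DecidableEq (DirichletCharacter ℂ q)} :
    (#({1}ᶜ : Finset (DirichletCharacter ℂ q)) : ℝ) ≤ q := by
  have h1 : #({1}ᶜ : Finset (DirichletCharacter ℂ q)) ≤ Fintype.card (DirichletCharacter ℂ q) :=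
    Finset.card_le_univ _
  have h2 : Fintype.card (DirichletCharacter ℂ q) = q.totient := by
    rw [← Nat.card_eq_fintype_card]
    exact DirichletCharacter.card_eq_totient_of_hasEnoughRootsOfUnity ℂ q
  have h3 := Nat.totient_le q
  exact_mod_cast h1.trans (h2 ▸ h3)

/-- The non-principal part of `F_{q,a}`: if `‖L'/L(s, χ)‖ ≤ B log(|t|+4)` for all `χ ≠ χ₀`
mod `q`, then `‖∑_{χ ≠ χ₀} χ̄(a) L'/L(s, χ)‖ ≤ q B log(|t| + 4)`. [folklore] -/
theorem norm_sum_chars_le {q : ℕ} [NeZero q] {inst : DecidableEq (DirichletCharacter ℂ q)}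
    (a : ZMod q) {s : ℂ} {B : ℝ} (hB : 0 ≤ B)
    (hχ : ∀ χ : DirichletCharacter ℂ q, χ ≠ 1 → χ.LFunction s ≠ 0 ∧
      ‖deriv χ.LFunction s / χ.LFunction s‖ ≤ B * Real.log (|s.im| + 4)) :
    ‖∑ χ ∈ ({1}ᶜ : Finset (DirichletCharacter ℂ q)), χ a⁻¹ * deriv χ.LFunction s / χ.LFunction s‖ ≤
      q * B * Real.log (|s.im| + 4) := by
  have hlogτ : 1 ≤ Real.log (|s.im| + 4) := ClassicalZFRData.one_le_log_tau s.im
  calc ‖∑ χ ∈ ({1}ᶜ : Finset (DirichletCharacter ℂ q)), χ a⁻¹ * deriv χ.LFunction s / χ.LFunction s‖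
      ≤ ∑ χ ∈ ({1}ᶜ : Finset (DirichletCharacter ℂ q)),
          ‖χ a⁻¹ * deriv χ.LFunction s / χ.LFunction s‖ := norm_sum_le _ _
    _ ≤ ∑ χ ∈ ({1}ᶜ : Finset (DirichletCharacter ℂ q)), B * Real.log (|s.im| + 4) := by
        refine Finset.sum_le_sum fun χ hχ' ↦ ?_
        have hχ1 : χ ≠ 1 := by simpa using hχ'
        rw [mul_div_assoc, norm_mul]
        calc ‖χ a⁻¹‖ * ‖deriv χ.LFunction s / χ.LFunction s‖
            ≤ 1 * (B * Real.log (|s.im| + 4)) :=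
              mul_le_mul (DirichletCharacter.norm_le_one χ _) (hχ χ hχ1).2 (norm_nonneg _) zero_le_one
          _ = B * Real.log (|s.im| + 4) := one_mul _
    _ = #({1}ᶜ : Finset (DirichletCharacter ℂ q)) * (B * Real.log (|s.im| + 4)) := by
        rw [Finset.sum_const, nsmul_eq_mul]
    _ ≤ q * (B * Real.log (|s.im| + 4)) :=
        mul_le_mul_of_nonneg_right (card_compl_one_le q) (by positivity)
    _ = q * B * Real.log (|s.im| + 4) := by ring

/-- **The bound `|F_{q,a}(s)| ≤ C_q log(|t| + 4)` on the region** (MV (11.22) with Theorem 11.4 for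
`χ ≠ χ₀` and Theorem 6.7 for `ζ`): `F_{q,a} = φ(q) · (Mathlib's `LFunctionResidueClassAux a`)
` = −L₁'/L₁(s, χ₀) − ∑_{χ ≠ χ₀} χ̄(a) L'/L(s, χ)`, and with `|L₁'/L₁| ≤ |ζ₁'/ζ₁| + 3 log q ≤
C_ζ log(|t|+4) + 3 log q`, `|L'/L(s,χ)| ≤ B log(|t|+4)` for the `≤ q` non-principal characters:
`|F_{q,a}(s)| ≤ (C_ζ + 3 log q + q B) log(|t| + 4)`; moreover `F_{q,a}` is differentiable at `s`.
[cite: MontgomeryVaughan2007, §11.3 eq. (11.22)] -/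
theorem residueClassAux_facts {q : ℕ} [NeZero q] (a : ZMod q) {s : ℂ} {Cζ B : ℝ}
    (hB : 0 ≤ B) (hs : 3 / 4 ≤ s.re) (hζ : riemannZeta₁ s ≠ 0)
    (hζb : ‖deriv riemannZeta₁ s / riemannZeta₁ s‖ ≤ Cζ * Real.log (|s.im| + 4))
    (hχ : ∀ χ : DirichletCharacter ℂ q, χ ≠ 1 → χ.LFunction s ≠ 0 ∧
      ‖deriv χ.LFunction s / χ.LFunction s‖ ≤ B * Real.log (|s.im| + 4)) :
    DifferentiableAt ℂ
        (fun s ↦ (q.totient : ℂ) * ArithmeticFunction.vonMangoldt.LFunctionResidueClassAux a s) s ∧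
      ‖(q.totient : ℂ) * ArithmeticFunction.vonMangoldt.LFunctionResidueClassAux a s‖ ≤
        (Cζ + 3 * Real.log q + q * B) * Real.log (|s.im| + 4) := by
  obtain ⟨hL₁, hL₁b⟩ := norm_logDeriv_LFunctionTrivChar₁_le q hs hζ
  have hφ : (q.totient : ℂ) ≠ 0 := by exact_mod_cast (Nat.totient_pos.2 (NeZero.pos q)).ne'
  have hlogτ : 1 ≤ Real.log (|s.im| + 4) := ClassicalZFRData.one_le_log_tau s.im
  have hlogq : 0 ≤ Real.log q := Real.log_natCast_nonneg q
  have hT := DirichletCharacter.differentiable_LFunctionTrivChar₁ q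
  have hT' : DifferentiableAt ℂ (deriv (DirichletCharacter.LFunctionTrivChar₁ q)) s :=
    ((hT.analyticAt s).deriv).differentiableAt
  constructor
  · -- differentiability (unfold Mathlib's definition and follow its shape)
    simp only [ArithmeticFunction.vonMangoldt.LFunctionResidueClassAux]
    refine DifferentiableAt.const_mul (DifferentiableAt.const_mul ?_ _) _
    refine DifferentiableAt.fun_sub ?_ ?_
    · exact hT'.fun_neg.fun_div (hT s) hL₁
    · refine DifferentiableAt.fun_sum fun χ hχ' ↦ ?_
      have hχ1 : χ ≠ 1 := by simpa using hχ'
      have hLχ := DirichletCharacter.differentiable_LFunction hχ1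
      have hLχ' : DifferentiableAt ℂ (deriv χ.LFunction) s :=
        ((hLχ.analyticAt s).deriv).differentiableAt
      exact (hLχ'.const_mul _).fun_div (hLχ s) (hχ χ hχ1).1
  · -- the bound
    simp only [ArithmeticFunction.vonMangoldt.LFunctionResidueClassAux, ← mul_assoc,
      mul_inv_cancel₀ hφ, one_mul]
    have h1 : ‖-deriv (DirichletCharacter.LFunctionTrivChar₁ q) s /
        DirichletCharacter.LFunctionTrivChar₁ q s‖ ≤ Cζ * Real.log (|s.im| + 4) + 3 * Real.log q := by
      rw [neg_div, norm_neg]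
      exact hL₁b.trans (add_le_add hζb le_rfl)
    refine (norm_sub_le _ _).trans (le_trans
      (b := (Cζ * Real.log (|s.im| + 4) + 3 * Real.log q) + q * B * Real.log (|s.im| + 4))
      (add_le_add h1 ?_) ?_)
    · exact norm_sum_chars_le a hB hχ
    · nlinarith

/-! ## The hypotheses of Landau's method for `Λ_{q,a}`, uniformly in `q` -/

/-- **MV Theorem 11.16 (Cases 1 and 3) with Corollary 11.15, as hypotheses for Landau's method.**
For every `ε > 0` there are constants `c₃, κ, c_ζ > 0`, `C_ζ, C₃ ≥ 0` such that for every
`q ≥ 1` and every reduced residue `a mod q`, the non-negative sequence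
`Λ_{q,a}(n) = φ(q) Λ(n) 𝟙_{n ≡ a (q)}` and `F_{q,a} = φ(q) ·` (Mathlib's
`LFunctionResidueClassAux a`) ` = −L₁'/L₁(s,χ₀) − ∑_{χ ≠ χ₀} χ̄(a) L'/L(s,χ)` satisfy
`Literature.ClassicalPsiData Λ_{q,a} F_{q,a} c_q C_q` (`∑ Λ_{q,a}(n)n^{-s} = 1/(s−1) + F_{q,a}(s)`,
MV (11.22); `F_{q,a}` holomorphic with `|F_{q,a}(s)| ≤ C_q log(|t|+4)` on `σ > 1 − c_q/log(|t|+4)`),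
with `c_q = min(c₃/(1 + log q), κq^{-ε}/8, c_ζ, 1/4)` and
`C_q = C_ζ + 3 log q + q C₃ (log q + log 4)³/min(κq^{-ε}/2, 1)`.
[cite: MontgomeryVaughan2007, Theorem 11.16 (proof, Cases 1 and 3)] -/
theorem exists_classicalPsiData {ε : ℝ} (hε : 0 < ε) :
    ∃ c₃ κ cζ Cζ C₃ : ℝ, 0 < c₃ ∧ 0 < κ ∧ 0 < cζ ∧ 0 ≤ Cζ ∧ 0 ≤ C₃ ∧
      ∀ (q : ℕ) [NeZero q] (a : ZMod q), IsUnit a →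
        ClassicalPsiData
          (fun n ↦ (q.totient : ℝ) * ArithmeticFunction.vonMangoldt.residueClass a n)
          (fun s ↦ (q.totient : ℂ) * ArithmeticFunction.vonMangoldt.LFunctionResidueClassAux a s)
          (min (min (c₃ / (1 + Real.log q)) (κ * (q : ℝ) ^ (-ε) / 8)) (min cζ (1 / 4)))
          (Cζ + 3 * Real.log q +
            q * (C₃ * ((Real.log q + Real.log 4) ^ 3 / min (κ * (q : ℝ) ^ (-ε) / 2) 1))) := by
  obtain ⟨c₃, hc₃, C₃, hC₃, hzf, hL⟩ := DirichletZFR.exists_norm_logDeriv_le_of_re_ge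
  obtain ⟨κ, hκ, hSiegel⟩ := Siegel.exists_one_sub_realZero_ge hε
  obtain ⟨cζ, hcζ, Cζ, hCζ, hζ⟩ := Literature.NumberTheory.LFunctions.classicalZFRData_riemannZeta.norm_logDeriv_le
  refine ⟨c₃, κ, cζ, Cζ, C₃, hc₃, hκ, hcζ, hCζ, hC₃, fun q _ a ha ↦ ?_⟩
  have hq1 : (1 : ℝ) ≤ q := by exact_mod_cast NeZero.one_le
  have hq0 : (0 : ℝ) < q := by linarith
  have hlogq : 0 ≤ Real.log q := Real.log_nonneg hq1
  have hη : 0 < κ * (q : ℝ) ^ (-ε) := mul_pos hκ (Real.rpow_pos_of_pos hq0 _)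
  have hd : 0 < min (κ * (q : ℝ) ^ (-ε) / 2) 1 := lt_min (by linarith) one_pos
  have hlog4 : 0 < Real.log 4 := Real.log_pos (by norm_num)
  -- the constants `c_q`, `B_q`, `C_q`
  set cq : ℝ := min (min (c₃ / (1 + Real.log q)) (κ * (q : ℝ) ^ (-ε) / 8)) (min cζ (1 / 4)) with hcq
  have hcq0 : 0 < cq := lt_min (lt_min (div_pos hc₃ (by linarith)) (by linarith)) (lt_min hcζ (by norm_num))
  have hcq1 : cq ≤ c₃ / (1 + Real.log q) := (min_le_left _ _).trans (min_le_left _ _)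
  have hcq2 : cq ≤ κ * (q : ℝ) ^ (-ε) / 8 := (min_le_left _ _).trans (min_le_right _ _)
  have hcq3 : cq ≤ cζ := (min_le_right _ _).trans (min_le_left _ _)
  have hcq4 : cq ≤ 1 / 4 := (min_le_right _ _).trans (min_le_right _ _)
  clear_value cq
  set B : ℝ := C₃ * ((Real.log q + Real.log 4) ^ 3 / min (κ * (q : ℝ) ^ (-ε) / 2) 1) with hBdef
  have hB : 0 ≤ B := by rw [hBdef]; positivity
  clear_value B
  -- the analytic facts on the region
  have hregion : ∀ s : ℂ, 1 - cq / Real.log (|s.im| + 4) < s.re →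
      DifferentiableAt ℂ
          (fun s ↦ (q.totient : ℂ) * ArithmeticFunction.vonMangoldt.LFunctionResidueClassAux a s) s ∧
        ‖(q.totient : ℂ) * ArithmeticFunction.vonMangoldt.LFunctionResidueClassAux a s‖ ≤
          (Cζ + 3 * Real.log q + q * B) * Real.log (|s.im| + 4) := by
    intro s hs
    obtain ⟨h34, hη8, hsζ, hs₃⟩ := region_facts hq1 hc₃ hcq0 hcq1 hcq2 hcq3 hcq4 hs
    obtain ⟨hζne, hζb⟩ := hζ s (by linarith) hsζ
    have hχ : ∀ χ : DirichletCharacter ℂ q, χ ≠ 1 → χ.LFunction s ≠ 0 ∧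
        ‖deriv χ.LFunction s / χ.LFunction s‖ ≤ B * Real.log (|s.im| + 4) := by
      intro χ hχ1
      have := char_facts hκ hzf hL hSiegel χ hχ1 hη8 hs₃
      rw [← hBdef] at this
      exact this
    exact residueClassAux_facts a hB h34.le hζne hζb hχ
  -- the structure
  refine ⟨hcq0, fun n ↦ ?_, fun s hs ↦ ?_, fun s hs ↦ ?_, fun s hs ↦ ?_, fun s hs ↦ (hregion s hs).2⟩
  · exact mul_nonneg (Nat.cast_nonneg _) (ArithmeticFunction.vonMangoldt.residueClass_nonneg a n)
  · -- summability for `σ > 1`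
    have h1 : LSeriesSummable (↗(ArithmeticFunction.vonMangoldt.residueClass a)) s :=
      LSeriesSummable_of_abscissaOfAbsConv_lt_re
        ((ArithmeticFunction.vonMangoldt.abscissaOfAbsConv_residueClass_le_one a).trans_lt
          (by exact_mod_cast hs))
    have h2 := h1.smul (q.totient : ℂ)
    refine (LSeriesSummable_congr s fun {n} _ ↦ ?_).1 h2
    simp only [Pi.smul_apply, smul_eq_mul]
    push_cast
    ring
  · -- the identity `∑ Λ_{q,a}(n) n^{-s} = 1/(s−1) + F_{q,a}(s)` (MV (11.22))
    have hφ : (q.totient : ℂ) ≠ 0 := by exact_mod_cast (Nat.totient_pos.2 (NeZero.pos q)).ne'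
    have hAux := ArithmeticFunction.vonMangoldt.eqOn_LFunctionResidueClassAux ha hs
    have hsm : LSeries (fun n ↦ (((q.totient : ℝ) * ArithmeticFunction.vonMangoldt.residueClass a n : ℝ) : ℂ)) s
        = (q.totient : ℂ) * LSeries (↗(ArithmeticFunction.vonMangoldt.residueClass a)) s := by
      rw [← LSeries_smul]
      refine LSeries_congr (fun {n} _ ↦ ?_) s
      simp only [Pi.smul_apply, smul_eq_mul]
      push_cast
      ring
    rw [hsm]
    simp only at hAux
    rw [hAux]
    have hs1 : s - 1 ≠ 0 := by
      intro h; rw [sub_eq_zero] at h; rw [h] at hs; simp at hs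
    field_simp
    ring
  · -- holomorphy on the region
    exact (hregion s hs).1.differentiableWithinAt

/-! ## From `Λ_{q,a}` to `ψ(x; q, a)` -/

/-- `ψ_{Λ_{q,a}}(x) = φ(q) ψ(x; q, a)` (the `n = 0` term of `chebyshevPsiMod` vanishes). [folklore] -/
theorem psi_residue_eq (q : ℕ) (a : ZMod q) (x : ℝ) :
    ClassicalPsiData.psi (fun n ↦ (q.totient : ℝ) * ArithmeticFunction.vonMangoldt.residueClass a n) x =
      (q.totient : ℝ) * Literature.NumberTheory.Sieve.ParityWave0.chebyshevPsiMod q a x := by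
  rw [ClassicalPsiData.psi, Literature.NumberTheory.Sieve.ParityWave0.chebyshevPsiMod, ← Finset.mul_sum, Finset.range_eq_Ico,
    ← Finset.insert_Ico_add_one_left_eq_Ico (Nat.succ_pos _), Finset.sum_insert (by simp)]
  simp only [ArithmeticFunction.vonMangoldt.residueClass_apply_zero, zero_add]
  congr 1

/-- `ψ_{Λ_{q,a}}(6) ≤ 12 φ(q)` (`Λ_{q,a}(n) ≤ φ(q) Λ(n) ≤ φ(q) log n ≤ 2φ(q)` for `n ≤ 6`). [folklore] -/
theorem psi_residue_six_le (q : ℕ) (a : ZMod q) :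
    ClassicalPsiData.psi (fun n ↦ (q.totient : ℝ) * ArithmeticFunction.vonMangoldt.residueClass a n) 6 ≤
      12 * q.totient := by
  rw [ClassicalPsiData.psi, ← Finset.mul_sum]
  have hfl : ⌊(6 : ℝ)⌋₊ = 6 := by norm_num
  rw [hfl]
  have h : ∑ n ∈ Finset.Ioc 0 6, ArithmeticFunction.vonMangoldt.residueClass a n ≤ 12 := by
    calc ∑ n ∈ Finset.Ioc 0 6, ArithmeticFunction.vonMangoldt.residueClass a n
        ≤ ∑ n ∈ Finset.Ioc 0 6, (2 : ℝ) := by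
          refine Finset.sum_le_sum fun n hn ↦ ?_
          rw [Finset.mem_Ioc] at hn
          have h1 := ArithmeticFunction.vonMangoldt.residueClass_le a n
          have h2 : Λ n ≤ Real.log n := ArithmeticFunction.vonMangoldt_le_log
          have h3 : Real.log n ≤ 2 := by
            have hn6 : (n : ℝ) ≤ 6 := by exact_mod_cast hn.2
            have hn0 : (0 : ℝ) < n := by exact_mod_cast hn.1
            calc Real.log n ≤ Real.log 6 := Real.log_le_log hn0 hn6
              _ ≤ Real.log (Real.exp 2) := by
                  refine Real.log_le_log (by norm_num) ?_
                  have h1 := Real.exp_one_gt_d9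
                  have h' : Real.exp 2 = Real.exp 1 * Real.exp 1 := by rw [← Real.exp_add]; norm_num
                  rw [h']
                  nlinarith
              _ = 2 := Real.log_exp 2
          linarith
      _ = 12 := by simp; norm_num
  rw [mul_comm (12 : ℝ)]
  exact mul_le_mul_of_nonneg_left h (Nat.cast_nonneg _)

/-- `V^N e^{−mV} ≤ N!/m^N` for `m > 0`, `V ≥ 0` (from `y^N/N! ≤ e^y`). [folklore] -/
theorem pow_mul_exp_neg_le {m V : ℝ} (hm : 0 < m) (hV : 0 ≤ V) (N : ℕ) :
    V ^ N * Real.exp (-(m * V)) ≤ N.factorial / m ^ N := by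
  have h := Real.pow_div_factorial_le_exp (m * V) (mul_nonneg hm.le hV) N
  rw [mul_pow, div_le_iff₀ (by positivity)] at h
  rw [Real.exp_neg, le_div_iff₀ (pow_pos hm N)]
  have hE := Real.exp_pos (m * V)
  calc V ^ N * (Real.exp (m * V))⁻¹ * m ^ N = (m ^ N * V ^ N) / Real.exp (m * V) := by
        field_simp
    _ ≤ (Real.exp (m * V) * N.factorial) / Real.exp (m * V) :=
        div_le_div_of_nonneg_right h hE.le
    _ = N.factorial := by field_simp

/-! ## The Siegel–Walfisz theorem -/

set_option maxHeartbeats 1600000 in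
/-- **The Siegel–Walfisz theorem for `A ≥ 1`** (MV Cor. 11.19 with the log-power saving of
parity.S28): there is `C = C(A)` with `|ψ(x; q, a) − x/φ(q)| ≤ C x/(log x)^A` for all `x ≥ 2`,
`1 ≤ q ≤ (log x)^A`, `(a, q) = 1`. From `exists_classicalPsiData` (with `ε = 1/(4A)`) and the explicit
Landau estimate `ClassicalPsiData.abs_psi_sub_le_explicit`:
`|φ(q)ψ(x;q,a) − x| ≤ K_q x exp(−(c_q/24)√log x)` with `K_q ≤ k₃ (log x)^{6A}` and
`c_q ≥ m₁ (log x)^{-1/4}`, so that `K_q exp(−(c_q/24)√log x) ≤ k₃ N!(24/m₁)^N (log x)^{-A}`,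
`N = ⌈28A⌉` (`y^N/N! ≤ e^y`). [cite: MontgomeryVaughan2007, Corollary 11.19] -/
theorem siegel_walfisz_of_one_le {A : ℝ} (hA : 1 ≤ A) :
    ∃ C : ℝ, ∀ x : ℝ, 2 ≤ x → ∀ q : ℕ, 1 ≤ q → (q : ℝ) ≤ Real.log x ^ A →
      ∀ a : (ZMod q)ˣ,
        |Literature.NumberTheory.Sieve.ParityWave0.chebyshevPsiMod q a x - x / Nat.totient q| ≤ C * x / Real.log x ^ A := by
  have hA0 : 0 < A := by linarith
  set ε : ℝ := 1 / (4 * A) with hεdef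
  have hε : 0 < ε := by positivity
  have hAε : A * ε = 1 / 4 := by rw [hεdef]; field_simp
  obtain ⟨c₃, κ, cζ, Cζ, C₃, hc₃, hκ, hcζ, hCζ, hC₃, hData⟩ := exists_classicalPsiData hε
  -- absolute constants (depending on `A` only)
  set m₁ : ℝ := min (min (c₃ / (1 + 4 * A ^ 2)) (κ / 8)) (min cζ (1 / 4)) with hm₁
  have hm₁0 : 0 < m₁ := lt_min (lt_min (by positivity) (by positivity)) (lt_min hcζ (by norm_num))
  have hm₁a : m₁ ≤ c₃ / (1 + 4 * A ^ 2) := (min_le_left _ _).trans (min_le_left _ _)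
  have hm₁b : m₁ ≤ κ / 8 := (min_le_left _ _).trans (min_le_right _ _)
  have hm₁c : m₁ ≤ cζ := (min_le_right _ _).trans (min_le_left _ _)
  have hm₁d : m₁ ≤ 1 / 4 := (min_le_right _ _).trans (min_le_right _ _)
  clear_value m₁
  set m₂ : ℝ := min (κ / 2) 1 with hm₂
  have hm₂0 : 0 < m₂ := lt_min (by positivity) one_pos
  have hm₂a : m₂ ≤ κ / 2 := min_le_left _ _
  have hm₂b : m₂ ≤ 1 := min_le_right _ _
  clear_value m₂
  set e : ℝ := Real.exp 1 with he
  have he0 : 0 < e := Real.exp_pos 1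
  set k₁ : ℝ := Cζ + 3 + 27 * C₃ / m₂ with hk₁
  have hk₁0 : 0 ≤ k₁ := by rw [hk₁]; positivity
  set k₂ : ℝ := k₁ * (32 * e + 144 * Real.pi / m₁) + 1 with hk₂
  have hk₂0 : 0 ≤ k₂ := by rw [hk₂]; positivity
  set k₃ : ℝ := 1 / 4 + 8 * k₂ + 9 * e ^ 2 with hk₃
  have hk₃0 : 0 ≤ k₃ := by rw [hk₃]; positivity
  set N : ℕ := ⌈28 * A⌉₊ with hN
  have hN28 : 28 * A ≤ N := Nat.le_ceil _
  set C : ℝ := k₃ * (N.factorial * (24 / m₁) ^ N) with hCdef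
  refine ⟨C, fun x hx q hq hqx a ↦ ?_⟩
  haveI : NeZero q := ⟨by omega⟩
  have ha : IsUnit (a : ZMod q) := Units.isUnit a
  -- `Lx = log x ≥ 1`, `U = Lx^A ≥ q`, `V = Lx^{1/4}`
  have hx0 : 0 < x := by linarith
  set Lx : ℝ := Real.log x with hLdef
  have hL0 : 0 < Lx := Real.log_pos (by linarith)
  have hq1 : (1 : ℝ) ≤ q := by exact_mod_cast hq
  have hL1 : 1 ≤ Lx := by
    by_contra hcon
    have : Lx ^ A < 1 := Real.rpow_lt_one hL0.le (not_le.1 hcon) hA0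
    linarith
  set U : ℝ := Lx ^ A with hUdef
  have hU1 : 1 ≤ U := Real.one_le_rpow hL1 hA0.le
  have hU0 : 0 < U := by linarith
  have hqU : (q : ℝ) ≤ U := hqx
  set V : ℝ := Lx ^ (1 / 4 : ℝ) with hVdef
  have hV1 : 1 ≤ V := Real.one_le_rpow hL1 (by norm_num)
  have hV0 : 0 < V := by linarith
  have hVU : V ≤ U := Real.rpow_le_rpow_of_exponent_le hL1 (by linarith)
  have hq0 : (0 : ℝ) < q := by linarith
  -- `q`-quantities in terms of `U`, `V`
  have hlogq0 : 0 ≤ Real.log q := Real.log_nonneg hq1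
  have hlogqU : Real.log q ≤ U := by
    have := Real.log_le_sub_one_of_pos hq0
    linarith only [this, hqU]
  have hlogqV : 1 + Real.log q ≤ (1 + 4 * A ^ 2) * V := by
    have h1 : Real.log q ≤ Real.log U := Real.log_le_log hq0 hqU
    have h2 : Real.log U = A * Real.log Lx := by rw [hUdef, Real.log_rpow hL0]
    have h3 : Real.log Lx ≤ Lx ^ ε / ε := Real.log_le_rpow_div hL0.le hε
    have h4 : Lx ^ ε ≤ V := by
      rw [hVdef]
      refine Real.rpow_le_rpow_of_exponent_le hL1 ?_
      rw [hεdef, div_le_div_iff₀ (by positivity) (by norm_num)]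
      linarith
    have h5 : Real.log q ≤ 4 * A ^ 2 * V := by
      calc Real.log q ≤ A * Real.log Lx := by linarith only [h1, h2]
        _ ≤ A * (Lx ^ ε / ε) := mul_le_mul_of_nonneg_left h3 hA0.le
        _ = 4 * A ^ 2 * Lx ^ ε := by rw [hεdef]; field_simp
        _ ≤ 4 * A ^ 2 * V := mul_le_mul_of_nonneg_left h4 (by positivity)
    have e1 : (1 + 4 * A ^ 2) * V = V + 4 * A ^ 2 * V := by ring
    linarith only [h5, hV1, e1]
  have hqε : V⁻¹ ≤ (q : ℝ) ^ (-ε) := by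
    have h1 : U ^ (-ε) ≤ (q : ℝ) ^ (-ε) := Real.rpow_le_rpow_of_nonpos hq0 hqU (by linarith)
    have h2 : U ^ (-ε) = V⁻¹ := by
      rw [hUdef, hVdef, ← Real.rpow_mul hL0.le, ← Real.rpow_neg hL0.le]
      congr 1
      rw [← hAε]; ring
    rw [← h2]; exact h1
  -- lower bounds for `c_q` and `d_q`
  have hcq : m₁ / V ≤ min (min (c₃ / (1 + Real.log q)) (κ * (q : ℝ) ^ (-ε) / 8)) (min cζ (1 / 4)) := by
    have hmV : m₁ / V ≤ m₁ := div_le_self hm₁0.le hV1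
    refine le_min (le_min ?_ ?_) (le_min (hmV.trans hm₁c) (hmV.trans hm₁d))
    · calc m₁ / V ≤ (c₃ / (1 + 4 * A ^ 2)) / V := div_le_div_of_nonneg_right hm₁a hV0.le
        _ = c₃ / ((1 + 4 * A ^ 2) * V) := by rw [div_div]
        _ ≤ c₃ / (1 + Real.log q) := div_le_div_of_nonneg_left hc₃.le (by linarith) hlogqV
    · calc m₁ / V ≤ (κ / 8) / V := div_le_div_of_nonneg_right hm₁b hV0.le
        _ = κ * V⁻¹ / 8 := by ring
        _ ≤ κ * (q : ℝ) ^ (-ε) / 8 := by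
            refine div_le_div_of_nonneg_right (mul_le_mul_of_nonneg_left hqε hκ.le) (by norm_num)
  have hdq : m₂ / V ≤ min (κ * (q : ℝ) ^ (-ε) / 2) 1 := by
    refine le_min ?_ ((div_le_self hm₂0.le hV1).trans hm₂b)
    calc m₂ / V ≤ (κ / 2) / V := div_le_div_of_nonneg_right hm₂a hV0.le
      _ = κ * V⁻¹ / 2 := by ring
      _ ≤ κ * (q : ℝ) ^ (-ε) / 2 :=
          div_le_div_of_nonneg_right (mul_le_mul_of_nonneg_left hqε hκ.le) (by norm_num)
  -- the data and Landau's explicit estimate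
  have hD := hData q (a : ZMod q) ha
  have hP := hD.abs_psi_sub_le_explicit hx
  set cq : ℝ := min (min (c₃ / (1 + Real.log q)) (κ * (q : ℝ) ^ (-ε) / 8)) (min cζ (1 / 4)) with hcqdef
  set dq : ℝ := min (κ * (q : ℝ) ^ (-ε) / 2) 1 with hdqdef
  have hcq0 : 0 < cq := lt_of_lt_of_le (div_pos hm₁0 hV0) hcq
  have hcq4 : cq ≤ 1 / 4 := (min_le_right _ _).trans (min_le_right _ _)
  have hdq0 : 0 < dq := lt_of_lt_of_le (div_pos hm₂0 hV0) hdq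
  have hdq1 : dq ≤ 1 := min_le_right _ _
  clear_value cq dq
  have hcq2 : cq ≤ 1 / 2 := by linarith only [hcq4]
  have hmin : min cq (1 / 2) = cq := min_eq_left hcq2
  rw [hmin] at hP
  -- keep the analytic estimate out of the context during the arithmetic
  revert hP
  clear hD
  -- bounds for the pieces of the constant
  have hlog4 : Real.log 4 < 2 := by
    have h1 := Real.exp_one_gt_d9
    have h' : Real.exp 2 = Real.exp 1 * Real.exp 1 := by rw [← Real.exp_add]; norm_num
    rw [Real.log_lt_iff_lt_exp (by norm_num), h']
    nlinarith
  have hlog40 : 0 < Real.log 4 := Real.log_pos (by norm_num)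
  have hℒ₀ : Real.log q + Real.log 4 ≤ 3 * U := by linarith only [hlogqU, hlog4, hU1]
  have hℒ₀0 : 0 ≤ Real.log q + Real.log 4 := by linarith only [hlogq0, hlog40]
  have hinvd : 1 / dq ≤ V / m₂ := by
    rw [div_le_div_iff₀ hdq0 hm₂0]
    have := (div_le_iff₀ hV0).1 hdq
    linarith only [this]
  have hinvc : 1 / cq ≤ V / m₁ := by
    rw [div_le_div_iff₀ hcq0 hm₁0]
    have := (div_le_iff₀ hV0).1 hcq
    linarith only [this]
  have hU5 : 1 ≤ U ^ 5 := one_le_pow₀ hU1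
  have hUU5 : U ≤ U ^ 5 := le_self_pow₀ hU1 (by norm_num)
  have hUU6 : U ≤ U ^ 6 := le_self_pow₀ hU1 (by norm_num)
  have hU6one : 1 ≤ U ^ 6 := one_le_pow₀ hU1
  -- `C_q ≤ k₁ U⁵`
  have hCq : Cζ + 3 * Real.log q + q * (C₃ * ((Real.log q + Real.log 4) ^ 3 / dq)) ≤ k₁ * U ^ 5 := by
    have h1 : (Real.log q + Real.log 4) ^ 3 ≤ 27 * U ^ 3 := by
      calc (Real.log q + Real.log 4) ^ 3 ≤ (3 * U) ^ 3 := pow_le_pow_left₀ hℒ₀0 hℒ₀ 3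
        _ = 27 * U ^ 3 := by ring
    have h2 : (Real.log q + Real.log 4) ^ 3 / dq ≤ 27 * U ^ 3 * (V / m₂) := by
      rw [div_eq_mul_one_div]
      exact mul_le_mul h1 hinvd (by positivity) (by positivity)
    have h3 : q * (C₃ * ((Real.log q + Real.log 4) ^ 3 / dq)) ≤ U * (C₃ * (27 * U ^ 3 * (U / m₂))) := by
      refine mul_le_mul hqU (mul_le_mul_of_nonneg_left (h2.trans ?_) hC₃) (by positivity) hU0.le
      exact mul_le_mul_of_nonneg_left (div_le_div_of_nonneg_right hVU hm₂0.le) (by positivity)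
    have h4 : U * (C₃ * (27 * U ^ 3 * (U / m₂))) = 27 * C₃ / m₂ * U ^ 5 := by
      field_simp
    have h5 : Cζ ≤ Cζ * U ^ 5 := le_mul_of_one_le_right hCζ hU5
    have h6 : 3 * Real.log q ≤ 3 * U ^ 5 := by linarith only [hlogqU, hUU5]
    have e : k₁ * U ^ 5 = Cζ * U ^ 5 + 3 * U ^ 5 + 27 * C₃ / m₂ * U ^ 5 := by rw [hk₁]; ring
    linarith only [h3, h4, h5, h6, e]
  -- `C_q (32e + 12π/(c_q/12)) + 1 ≤ k₂ U⁶`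
  have hT : (Cζ + 3 * Real.log q + q * (C₃ * ((Real.log q + Real.log 4) ^ 3 / dq))) *
      (32 * Real.exp 1 + 12 * Real.pi / (cq / 12)) + 1 ≤ k₂ * U ^ 6 := by
    have hπ : 0 < Real.pi := Real.pi_pos
    have h1 : 12 * Real.pi / (cq / 12) = 144 * Real.pi * (1 / cq) := by field_simp; ring
    have h2 : 12 * Real.pi / (cq / 12) ≤ 144 * Real.pi / m₁ * U := by
      rw [h1]
      calc 144 * Real.pi * (1 / cq) ≤ 144 * Real.pi * (V / m₁) := mul_le_mul_of_nonneg_left hinvc (by positivity)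
        _ ≤ 144 * Real.pi * (U / m₁) :=
            mul_le_mul_of_nonneg_left (div_le_div_of_nonneg_right hVU hm₁0.le) (by positivity)
        _ = 144 * Real.pi / m₁ * U := by ring
    have h3 : 32 * Real.exp 1 + 12 * Real.pi / (cq / 12) ≤ (32 * e + 144 * Real.pi / m₁) * U := by
      rw [← he, add_mul]
      have : 32 * e ≤ 32 * e * U := le_mul_of_one_le_right (by positivity) hU1
      linarith only [h2, this]
    have hCq0 : 0 ≤ Cζ + 3 * Real.log q + q * (C₃ * ((Real.log q + Real.log 4) ^ 3 / dq)) := by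
      positivity
    have h32 : 0 ≤ 32 * Real.exp 1 + 12 * Real.pi / (cq / 12) := by positivity
    have hk₁U : 0 ≤ k₁ * U ^ 5 := by positivity
    have h4 := mul_le_mul hCq h3 h32 hk₁U
    have h5 : k₁ * U ^ 5 * ((32 * e + 144 * Real.pi / m₁) * U) = k₁ * (32 * e + 144 * Real.pi / m₁) * U ^ 6 := by
      ring
    have e2 : k₂ * U ^ 6 = k₁ * (32 * e + 144 * Real.pi / m₁) * U ^ 6 + U ^ 6 := by rw [hk₂]; ring
    linarith only [h4, h5, hU6one, e2]
  -- `ψ_{Λ}(6) ≤ 12 q ≤ 12 U`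
  have hψ6 := psi_residue_six_le q (a : ZMod q)
  have hφq : (q.totient : ℝ) ≤ q := by exact_mod_cast Nat.totient_le q
  have hφ1 : (1 : ℝ) ≤ q.totient := by exact_mod_cast Nat.totient_pos.2 (NeZero.pos q)
  -- the full constant `K_q ≤ k₃ U⁶`
  have hK : (1 / 4 + 8 * ((Cζ + 3 * Real.log q + q * (C₃ * ((Real.log q + Real.log 4) ^ 3 / dq))) *
      (32 * Real.exp 1 + 12 * Real.pi / (cq / 12)) + 1)) +
      (ClassicalPsiData.psi (fun n ↦ (q.totient : ℝ) * ArithmeticFunction.vonMangoldt.residueClass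
        (a : ZMod q) n) 6 + 6) * (Real.exp 2 / 2) ≤ k₃ * U ^ 6 := by
    have h1 : Real.exp 2 = e ^ 2 := by rw [he, ← Real.exp_nat_mul]; norm_num
    have h2 : (ClassicalPsiData.psi (fun n ↦ (q.totient : ℝ) *
        ArithmeticFunction.vonMangoldt.residueClass (a : ZMod q) n) 6 + 6) * (Real.exp 2 / 2) ≤
        9 * e ^ 2 * U ^ 6 := by
      rw [h1]
      have h18 : ClassicalPsiData.psi (fun n ↦ (q.totient : ℝ) *
          ArithmeticFunction.vonMangoldt.residueClass (a : ZMod q) n) 6 + 6 ≤ 18 * U ^ 6 := by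
        linarith only [hψ6, hφq, hqU, hUU6, hU6one]
      have he2 : 0 ≤ e ^ 2 / 2 := by positivity
      calc (ClassicalPsiData.psi (fun n ↦ (q.totient : ℝ) *
            ArithmeticFunction.vonMangoldt.residueClass (a : ZMod q) n) 6 + 6) * (e ^ 2 / 2)
          ≤ 18 * U ^ 6 * (e ^ 2 / 2) := mul_le_mul_of_nonneg_right h18 he2
        _ = 9 * e ^ 2 * U ^ 6 := by ring
    have e3 : k₃ * U ^ 6 = 1 / 4 * U ^ 6 + 8 * (k₂ * U ^ 6) + 9 * e ^ 2 * U ^ 6 := by rw [hk₃]; ring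
    linarith only [hT, h2, hU6one, e3]
  -- the exponential factor
  have hsqrt : Real.sqrt Lx = V ^ 2 := by
    rw [Real.sqrt_eq_rpow, hVdef, ← Real.rpow_natCast, ← Real.rpow_mul hL0.le]
    norm_num
  have hexp : Real.exp (-(cq / 12 / 2) * Real.sqrt (Real.log x)) ≤ Real.exp (-(m₁ / 24 * V)) := by
    rw [Real.exp_le_exp, ← hLdef, hsqrt]
    have h1 : m₁ * V ≤ cq * V ^ 2 := by
      have := (div_le_iff₀ hV0).1 hcq
      calc m₁ * V ≤ (cq * V) * V := mul_le_mul_of_nonneg_right this hV0.le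
        _ = cq * V ^ 2 := by ring
    have e4 : -(cq / 12 / 2) * V ^ 2 = -(cq * V ^ 2) / 24 := by ring
    have e5 : -(m₁ / 24 * V) = -(m₁ * V) / 24 := by ring
    rw [e4, e5]
    linarith only [h1]
  -- assemble: `|φ(q)ψ(x;q,a) − x| ≤ k₃ U⁶ x e^{−m₁V/24}`
  intro hP
  have hmain : |(q.totient : ℝ) * Literature.NumberTheory.Sieve.ParityWave0.chebyshevPsiMod q a x - x| ≤
      k₃ * U ^ 6 * x * Real.exp (-(m₁ / 24 * V)) := by
    rw [← psi_residue_eq]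
    refine hP.trans ?_
    have hKnn : 0 ≤ k₃ * U ^ 6 := by positivity
    exact mul_le_mul (mul_le_mul_of_nonneg_right hK hx0.le) hexp (Real.exp_pos _).le
      (mul_nonneg hKnn hx0.le)
  -- `k₃ U⁶ e^{−m₁V/24} ≤ C/U`
  have hdecay : k₃ * U ^ 6 * Real.exp (-(m₁ / 24 * V)) ≤ C / U := by
    rw [le_div_iff₀ hU0]
    have h1 : U ^ 7 ≤ V ^ N := by
      rw [hUdef, hVdef, ← Real.rpow_natCast, ← Real.rpow_natCast, ← Real.rpow_mul hL0.le,
        ← Real.rpow_mul hL0.le]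
      refine Real.rpow_le_rpow_of_exponent_le hL1 ?_
      push_cast
      linarith
    have h2 := pow_mul_exp_neg_le (m := m₁ / 24) (by positivity) hV0.le N
    have h3 : (N.factorial : ℝ) / (m₁ / 24) ^ N = N.factorial * (24 / m₁) ^ N := by
      rw [div_pow, div_pow]; field_simp
    rw [h3] at h2
    calc k₃ * U ^ 6 * Real.exp (-(m₁ / 24 * V)) * U = k₃ * (U ^ 7 * Real.exp (-(m₁ / 24 * V))) := by
          ring
      _ ≤ k₃ * (V ^ N * Real.exp (-(m₁ / 24 * V))) :=
          mul_le_mul_of_nonneg_left (mul_le_mul_of_nonneg_right h1 (Real.exp_pos _).le) hk₃0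
      _ ≤ k₃ * (N.factorial * (24 / m₁) ^ N) := mul_le_mul_of_nonneg_left h2 hk₃0
      _ = C := by rw [hCdef]
  -- conclude
  have hφ0 : (0 : ℝ) < q.totient := by linarith
  have hdiv : |Literature.NumberTheory.Sieve.ParityWave0.chebyshevPsiMod q a x - x / q.totient| =
      |(q.totient : ℝ) * Literature.NumberTheory.Sieve.ParityWave0.chebyshevPsiMod q a x - x| / q.totient := by
    rw [← abs_of_pos hφ0, ← abs_div, abs_of_pos hφ0]
    congr 1
    field_simp
  rw [hdiv, div_le_iff₀ hφ0]
  calc |(q.totient : ℝ) * Literature.NumberTheory.Sieve.ParityWave0.chebyshevPsiMod q a x - x|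
      ≤ k₃ * U ^ 6 * x * Real.exp (-(m₁ / 24 * V)) := hmain
    _ = (k₃ * U ^ 6 * Real.exp (-(m₁ / 24 * V))) * x := by ring
    _ ≤ (C / U) * x := mul_le_mul_of_nonneg_right hdecay hx0.le
    _ = C * x / Real.log x ^ A * 1 := by rw [hUdef, hLdef]; ring
    _ ≤ C * x / Real.log x ^ A * q.totient := by
        refine mul_le_mul_of_nonneg_left hφ1 ?_
        have : 0 ≤ C := by rw [hCdef]; positivity
        positivity

end Literature.NumberTheory.LFunctions.SiegelWalfisz

/-! ## parity.S28 -/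

namespace Literature.NumberTheory.LFunctions

/-- **parity.S28, the Siegel–Walfisz theorem, PROVED** (Walfisz 1936; Montgomery–Vaughan
Cor. 11.19; Iwaniec–Kowalski Cor. 5.29): for every `A > 0` there is an (ineffective) `C` with
`|ψ(x; q, a) − x/φ(q)| ≤ C x (log x)^{-A}` for all `x ≥ 2`, `1 ≤ q ≤ (log x)^A`, `(a, q) = 1`.
Reduced to `A ≥ 1` (`Literature.NumberTheory.LFunctions.SiegelWalfisz.siegel_walfisz_of_one_le`): for `q ≤ (log x)^A` one has
`log x ≥ 1`, so the statement for `max(A, 1)` implies it for `A`.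
[cite: Walfisz1936] [cite: MontgomeryVaughan2007, Corollary 11.19] -/
theorem siegel_walfisz_holds : Sieve.siegel_walfisz := by
  intro A hA
  obtain ⟨C, hC⟩ := Literature.NumberTheory.LFunctions.SiegelWalfisz.siegel_walfisz_of_one_le (le_max_right A 1)
  refine ⟨max C 0, fun x hx q hq hqx a ↦ ?_⟩
  have hL0 : 0 < Real.log x := Real.log_pos (by linarith)
  have hq1 : (1 : ℝ) ≤ q := by exact_mod_cast hq
  have hL1 : 1 ≤ Real.log x := by
    by_contra hcon
    have : Real.log x ^ A < 1 := Real.rpow_lt_one hL0.le (not_le.1 hcon) hA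
    linarith
  have hpow : Real.log x ^ A ≤ Real.log x ^ max A 1 :=
    Real.rpow_le_rpow_of_exponent_le hL1 (le_max_left _ _)
  have h := hC x hx q hq (hqx.trans hpow) a
  have hx0 : 0 < x := by linarith
  have hpA : 0 < Real.log x ^ A := Real.rpow_pos_of_pos hL0 _
  have hpM : 0 < Real.log x ^ max A 1 := Real.rpow_pos_of_pos hL0 _
  calc |Sieve.ParityWave0.chebyshevPsiMod q a x - x / Nat.totient q| ≤ C * x / Real.log x ^ max A 1 := h
    _ ≤ max C 0 * x / Real.log x ^ max A 1 :=
        div_le_div_of_nonneg_right (mul_le_mul_of_nonneg_right (le_max_left _ _) hx0.le) hpM.le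
    _ ≤ max C 0 * x / Real.log x ^ A :=
        div_le_div_of_nonneg_left (by positivity) hpA hpow

end Literature.NumberTheory.LFunctions
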